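import Summits.CriticalPhenomena.PercolationContinuityZ3.Theorems.PercNearOneGluingNoHeavyLowerTailIncStarOneTargetSideEvents
import Summits.CriticalPhenomena.PercolationContinuityZ3.Theorems.PercNearOneGluingNoHeavyLowerTailIncStarSlackEdgeBase
import Summits.CriticalPhenomena.PercolationContinuityZ3.Theorems.PercNearOneGluingNoHeavyLowerTailIncStarRootEdgeInduction
import HarnessLib

/-!
# One-target sides of two-separations (root outside), III: the moments

Support file for the Sahi programme (`--supports stmt-CriticalPhenomena-4575`, prover prim-sahi-p2 gen 24).  No definitions, no named
facts, no sorries; standard axioms.  Memo `run/shared/lean/prim/prim-sahi/FROM-prim-sahi-p2-gen24-ONE-TARGET-SIDE.md` §1.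

Setting of `…OneTargetSideEvents`: root side `R ∋ s`, separating vertices `u, v ∉ R`, no positive pair from `R` to the outside of
`R ∪ {u,v}`; `F` = pairs meeting `R`; far events `Xu = {s ~_F u}`, `Xv = {s ~_F v}`, `B t = {s ~_F t}`,
`B¹ t = B t ∪ ((Xu ∩ {v ~_F t}) ∪ (Xv ∩ {u ~_F t}))`; near events `Z = {u ↔ v in Rᶜ}`, `Au = {u ↔ a in Rᶜ}`, `Av = {v ↔ a in Rᶜ}`.
All events and all real numbers are passed as variables with defining hypotheses (instantiate with `rfl`).
* `real_twoLevel_eq` — `P(T₀ ∪ (Z ∩ T₁)) = (1−ζ)P(T₀) + ζP(T₁)` for far events `T₀ ⊆ T₁`;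
* `real_nearTarget_inter_eq` — `P(S_a ∩ (T₀ ∪ (Z ∩ T₁))) = v_u P(Xu ∩ T₀) + v_v P(Xv ∩ T₀) + v_Z P((Xu ∪ Xv) ∩ T₁)`, `S_a = (Au ∩ Xu) ∪ (Av ∩ Xv)`;
* `oneTargetSide_sahiE3_eq` — **(M1)** for `a ∉ R ∪ {u,v}`… precisely `a ∉ R`, and `b, c ∈ R ∪ {u,v}`:
  `E₃({s↔a},{s↔b},{s↔c}) = v_u Φ_u + v_v Φ_v + v_Z Φ_Z`;
* `oneTargetSide_sahiE3_port_eq` — **(M2)** `E₃({s↔u},{s↔b},{s↔c}) = (1−ζ) Φ_u + ζ Φ_Z` (the outside is felt only through `ζ` once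
  all targets are in `R ∪ {u,v}`: gen 11's blob identity in this vocabulary),
with the polynomials `Φ_u, Φ_v, Φ_Z` of `…OneTargetSideReal`.  THEOREM G′ is assembled in `…OneTargetSideGlue`.
-/

noncomputable section

namespace Summit.CriticalPhenomena.PercolationContinuityZ3.Theorems

namespace IncStarOneTargetSide

open MeasureTheory Set Literature.Probability.Percolation Literature.Probability.LatticeModels
open scoped Classical

variable {n : ℕ}

/-! ### Two-level far events against the near separator event -/

/-- **`P(T₀ ∪ (Z ∩ T₁)) = (1 − ζ)·P(T₀) + ζ·P(T₁)`** for far events `T₀ ⊆ T₁` (determined by the pairs meeting `R`) and the near event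
`Z = {u ↔ v in Rᶜ}`, `ζ = P(Z)`. [this work] -/
theorem real_twoLevel_eq (w : Sym2 (Fin n) → unitInterval) (R : Set (Fin n)) (u v : Fin n) {T₀ T₁ : Set (BondConfig (Fin n))}
    (hT : T₀ ⊆ T₁) (h₀ : DeterminedBy T₀ {e : Sym2 (Fin n) | ∃ y ∈ R, y ∈ e}) (h₁ : DeterminedBy T₁ {e : Sym2 (Fin n) | ∃ y ∈ R, y ∈ e})
    {ζ : ℝ} (hζ : ζ = (prodBernoulli w).real (openConnIn Rᶜ u v)) :
    (prodBernoulli w).real (T₀ ∪ (openConnIn Rᶜ u v ∩ T₁))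
      = (1 - ζ) * (prodBernoulli w).real T₀ + ζ * (prodBernoulli w).real T₁ := by
  subst hζ
  refine real_union_inter_eq hT ?_
  exact indep_near_far w R (SahiRootSide.determinedBy_openConnIn_compl R u v) (determinedBy_union_sdiff h₁ h₀).2

/-- **The near target against a two-level far event.**  With `S_a = (Au ∩ Xu) ∪ (Av ∩ Xv)` (`Au = {u ↔ a in Rᶜ}`, `Av`, far ports
`Xu, Xv` determined by the pairs meeting `R`) and far events `T₀ ⊆ T₁`:
`P(S_a ∩ (T₀ ∪ (Z ∩ T₁))) = P(Au ∖ Av)·P(Xu ∩ T₀) + P(Av ∖ Au)·P(Xv ∩ T₀) + P(Au ∩ Av)·P((Xu ∪ Xv) ∩ T₁)`. [this work] -/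
theorem real_nearTarget_inter_eq (w : Sym2 (Fin n) → unitInterval) (R : Set (Fin n)) (u v a : Fin n)
    {Xu Xv T₀ T₁ : Set (BondConfig (Fin n))} (hT : T₀ ⊆ T₁)
    (hXu : DeterminedBy Xu {e : Sym2 (Fin n) | ∃ y ∈ R, y ∈ e}) (hXv : DeterminedBy Xv {e : Sym2 (Fin n) | ∃ y ∈ R, y ∈ e})
    (h₀ : DeterminedBy T₀ {e : Sym2 (Fin n) | ∃ y ∈ R, y ∈ e}) (h₁ : DeterminedBy T₁ {e : Sym2 (Fin n) | ∃ y ∈ R, y ∈ e}) :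
    (prodBernoulli w).real (((openConnIn Rᶜ u a ∩ Xu) ∪ (openConnIn Rᶜ v a ∩ Xv)) ∩ (T₀ ∪ (openConnIn Rᶜ u v ∩ T₁)))
      = (prodBernoulli w).real (openConnIn Rᶜ u a \ openConnIn Rᶜ v a) * (prodBernoulli w).real (Xu ∩ T₀)
        + (prodBernoulli w).real (openConnIn Rᶜ v a \ openConnIn Rᶜ u a) * (prodBernoulli w).real (Xv ∩ T₀)
        + (prodBernoulli w).real (openConnIn Rᶜ u a ∩ openConnIn Rᶜ v a) * (prodBernoulli w).real ((Xu ∪ Xv) ∩ T₁) := by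
  have hm : ∀ X : Set (BondConfig (Fin n)), MeasurableSet X := fun _ => MeasurableSet.of_discrete
  set Au : Set (BondConfig (Fin n)) := openConnIn Rᶜ u a
  set Av : Set (BondConfig (Fin n)) := openConnIn Rᶜ v a
  set Z : Set (BondConfig (Fin n)) := openConnIn Rᶜ u v
  have f1 : Au ∩ Av ⊆ Z := fun ω h => (outside_ports_facts Rᶜ u v a ω).1 h.1 h.2
  have f2 : Z ∩ Au ⊆ Av := fun ω h => (outside_ports_facts Rᶜ u v a ω).2.1 h.1 h.2
  have f3 : Z ∩ Av ⊆ Au := fun ω h => (outside_ports_facts Rᶜ u v a ω).2.2 h.1 h.2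
  rw [nearTarget_inter_eq f1 f2 f3 hT]
  obtain ⟨d1, d2⟩ := nearTarget_pieces_disjoint Au Av (Xu ∩ T₀) (Xv ∩ T₀) ((Xu ∪ Xv) ∩ T₁)
  rw [measureReal_union d2 (hm _), measureReal_union d1 (hm _)]
  have nAu : DeterminedBy Au {e : Sym2 (Fin n) | ∃ y ∈ R, y ∈ e}ᶜ := SahiRootSide.determinedBy_openConnIn_compl R u a
  have nAv : DeterminedBy Av {e : Sym2 (Fin n) | ∃ y ∈ R, y ∈ e}ᶜ := SahiRootSide.determinedBy_openConnIn_compl R v a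
  rw [indep_near_far w R (determinedBy_union_sdiff nAu nAv).2 (hXu.inter h₀),
    indep_near_far w R (determinedBy_union_sdiff nAv nAu).2 (hXv.inter h₀),
    indep_near_far w R (nAu.inter nAv) (((determinedBy_union_sdiff hXu hXv).1).inter h₁)]


/-! ### (M1): the star with one target outside -/

set_option maxHeartbeats 400000 in
/-- **(M1) — `E₃` of the increasing star across a two-separation `{u, v}` not containing the root, one target outside.**
For `a ∉ R` and `b, c ∈ R ∪ {u, v}`:  `E₃({s↔a},{s↔b},{s↔c}) = v_u Φ_u + v_v Φ_v + v_Z Φ_Z` with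
`Φ_u = 2p_{ubc} − p_{ub}P_c − p_{uc}P_b − P_{bc}x_u + x_uP_bP_c`, `Φ_v` likewise, `Φ_Z = 2r_{bc} − r_bP_c − r_cP_b − P_{bc}ρ + ρP_bP_c`,
`P_b = (1−ζ)β + ζβ₁`, `P_c = (1−ζ)γ + ζγ₁`, `P_{bc} = (1−ζ)m + ζm₁` (events and numbers as in the module docstring, supplied through
defining hypotheses). [this work] -/
theorem oneTargetSide_sahiE3_eq (w : Sym2 (Fin n) → unitInterval) (R : Set (Fin n)) {s u v a b c : Fin n}
    (hs : s ∈ R) (ha : a ∉ R) (hb : b ∈ R ∨ b = u ∨ b = v) (hc : c ∈ R ∨ c = u ∨ c = v)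
    (hw : ∀ x ∈ R, ∀ z, z ∉ R → z ≠ u → z ≠ v → w s(x, z) = 0)
    {F : Set (Sym2 (Fin n))} (hF : F = {e : Sym2 (Fin n) | ∃ y ∈ R, y ∈ e})
    {Xu Xv Bb Bc B1b B1c : Set (BondConfig (Fin n))}
    (hXu : Xu = {ω | ω ∩ F ∈ (openConn s u : Set (BondConfig (Fin n)))})
    (hXv : Xv = {ω | ω ∩ F ∈ (openConn s v : Set (BondConfig (Fin n)))})
    (hBb : Bb = {ω | ω ∩ F ∈ (openConn s b : Set (BondConfig (Fin n)))})
    (hBc : Bc = {ω | ω ∩ F ∈ (openConn s c : Set (BondConfig (Fin n)))})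
    (hB1b : B1b = Bb ∪ ((Xu ∩ {ω | ω ∩ F ∈ (openConn v b : Set (BondConfig (Fin n)))})
      ∪ (Xv ∩ {ω | ω ∩ F ∈ (openConn u b : Set (BondConfig (Fin n)))})))
    (hB1c : B1c = Bc ∪ ((Xu ∩ {ω | ω ∩ F ∈ (openConn v c : Set (BondConfig (Fin n)))})
      ∪ (Xv ∩ {ω | ω ∩ F ∈ (openConn u c : Set (BondConfig (Fin n)))})))
    {ζ vu vv vZ xu xv ρ β γ m β₁ γ₁ m₁ pub puc pubc pvb pvc pvbc rb rc rbc : ℝ}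
    (hζ : ζ = (prodBernoulli w).real (openConnIn Rᶜ u v))
    (hvu : vu = (prodBernoulli w).real (openConnIn Rᶜ u a \ openConnIn Rᶜ v a))
    (hvv : vv = (prodBernoulli w).real (openConnIn Rᶜ v a \ openConnIn Rᶜ u a))
    (hvZ : vZ = (prodBernoulli w).real (openConnIn Rᶜ u a ∩ openConnIn Rᶜ v a))
    (hxu : xu = (prodBernoulli w).real Xu) (hxv : xv = (prodBernoulli w).real Xv) (hρ : ρ = (prodBernoulli w).real (Xu ∪ Xv))
    (hβ : β = (prodBernoulli w).real Bb) (hγ : γ = (prodBernoulli w).real Bc) (hm : m = (prodBernoulli w).real (Bb ∩ Bc))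
    (hβ₁ : β₁ = (prodBernoulli w).real B1b) (hγ₁ : γ₁ = (prodBernoulli w).real B1c) (hm₁ : m₁ = (prodBernoulli w).real (B1b ∩ B1c))
    (hpub : pub = (prodBernoulli w).real (Xu ∩ Bb)) (hpuc : puc = (prodBernoulli w).real (Xu ∩ Bc))
    (hpubc : pubc = (prodBernoulli w).real (Xu ∩ (Bb ∩ Bc)))
    (hpvb : pvb = (prodBernoulli w).real (Xv ∩ Bb)) (hpvc : pvc = (prodBernoulli w).real (Xv ∩ Bc))
    (hpvbc : pvbc = (prodBernoulli w).real (Xv ∩ (Bb ∩ Bc)))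
    (hrb : rb = (prodBernoulli w).real ((Xu ∪ Xv) ∩ B1b)) (hrc : rc = (prodBernoulli w).real ((Xu ∪ Xv) ∩ B1c))
    (hrbc : rbc = (prodBernoulli w).real ((Xu ∪ Xv) ∩ (B1b ∩ B1c))) :
    sahiE3 (prodBernoulli w) (openConn s a) (openConn s b) (openConn s c)
      = vu * (2 * pubc - pub * ((1 - ζ) * γ + ζ * γ₁) - puc * ((1 - ζ) * β + ζ * β₁) - ((1 - ζ) * m + ζ * m₁) * xu
              + xu * ((1 - ζ) * β + ζ * β₁) * ((1 - ζ) * γ + ζ * γ₁))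
        + vv * (2 * pvbc - pvb * ((1 - ζ) * γ + ζ * γ₁) - pvc * ((1 - ζ) * β + ζ * β₁) - ((1 - ζ) * m + ζ * m₁) * xv
              + xv * ((1 - ζ) * β + ζ * β₁) * ((1 - ζ) * γ + ζ * γ₁))
        + vZ * (2 * rbc - rb * ((1 - ζ) * γ + ζ * γ₁) - rc * ((1 - ζ) * β + ζ * β₁) - ((1 - ζ) * m + ζ * m₁) * ρ
              + ρ * ((1 - ζ) * β + ζ * β₁) * ((1 - ζ) * γ + ζ * γ₁)) := by
  subst hζ hvu hvv hvZ hxu hxv hρ hβ hγ hm hβ₁ hγ₁ hm₁ hpub hpuc hpubc hpvb hpvc hpvbc hrb hrc hrbc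
  subst hB1b hB1c
  subst hXu hXv hBb hBc
  subst hF
  have hmeas : ∀ X : Set (BondConfig (Fin n)), MeasurableSet X := fun _ => MeasurableSet.of_discrete
  -- names
  set F : Set (Sym2 (Fin n)) := {e : Sym2 (Fin n) | ∃ y ∈ R, y ∈ e} with hFd
  set Xu : Set (BondConfig (Fin n)) := {ω | ω ∩ F ∈ (openConn s u : Set (BondConfig (Fin n)))} with hXud
  set Xv : Set (BondConfig (Fin n)) := {ω | ω ∩ F ∈ (openConn s v : Set (BondConfig (Fin n)))} with hXvd
  set Bb : Set (BondConfig (Fin n)) := {ω | ω ∩ F ∈ (openConn s b : Set (BondConfig (Fin n)))} with hBbd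
  set Bc : Set (BondConfig (Fin n)) := {ω | ω ∩ F ∈ (openConn s c : Set (BondConfig (Fin n)))} with hBcd
  set Vb : Set (BondConfig (Fin n)) := {ω | ω ∩ F ∈ (openConn v b : Set (BondConfig (Fin n)))} with hVbd
  set Ub : Set (BondConfig (Fin n)) := {ω | ω ∩ F ∈ (openConn u b : Set (BondConfig (Fin n)))} with hUbd
  set Vc : Set (BondConfig (Fin n)) := {ω | ω ∩ F ∈ (openConn v c : Set (BondConfig (Fin n)))} with hVcd
  set Uc : Set (BondConfig (Fin n)) := {ω | ω ∩ F ∈ (openConn u c : Set (BondConfig (Fin n)))} with hUcd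
  set B1b : Set (BondConfig (Fin n)) := Bb ∪ ((Xu ∩ Vb) ∪ (Xv ∩ Ub)) with hB1bd
  set B1c : Set (BondConfig (Fin n)) := Bc ∪ ((Xu ∩ Vc) ∪ (Xv ∩ Uc)) with hB1cd
  set Z : Set (BondConfig (Fin n)) := openConnIn Rᶜ u v with hZd
  set Au : Set (BondConfig (Fin n)) := openConnIn Rᶜ u a with hAud
  set Av : Set (BondConfig (Fin n)) := openConnIn Rᶜ v a with hAvd
  set Sa : Set (BondConfig (Fin n)) := (Au ∩ Xu) ∪ (Av ∩ Xv) with hSa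
  set Sb : Set (BondConfig (Fin n)) := Bb ∪ (Z ∩ B1b) with hSb
  set Sc : Set (BondConfig (Fin n)) := Bc ∪ (Z ∩ B1c) with hSc
  -- (0) the sure set
  set G : Set (BondConfig (Fin n)) := {ω | ∀ e, w e = 0 → e ∉ ω}
  have hG1 : (prodBernoulli w).real G = 1 := IncStar.real_sureClosed w
  have hGω : ∀ ω ∈ G, ∀ x ∈ R, ∀ z, z ∉ R → z ≠ u → z ≠ v → s(x, z) ∉ ω :=
    fun ω hω x hx z hz hzu hzv => hω _ (hw x hx z hz hzu hzv)
  -- (1) the root events on the sure set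
  have cA : ∀ ω ∈ G, (ω ∈ openConn s a ↔ ω ∈ Sa) := by
    intro ω hω
    rw [twoCut_conn_outside_iff hs (hGω ω hω) ha]
    simp only [hSa, Set.mem_union, Set.mem_inter_iff]
    constructor
    · rintro (⟨h₁, h₂⟩ | ⟨h₁, h₂⟩)
      · exact Or.inl ⟨h₂, h₁⟩
      · exact Or.inr ⟨h₂, h₁⟩
    · rintro (⟨h₁, h₂⟩ | ⟨h₁, h₂⟩)
      · exact Or.inl ⟨h₂, h₁⟩
      · exact Or.inr ⟨h₂, h₁⟩
  have cfar : ∀ {t : Fin n} (ht : t ∈ R ∨ t = u ∨ t = v) (Bt Vt Ut : Set (BondConfig (Fin n))),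
      Bt = {ω | ω ∩ F ∈ (openConn s t : Set (BondConfig (Fin n)))} →
      Vt = {ω | ω ∩ F ∈ (openConn v t : Set (BondConfig (Fin n)))} →
      Ut = {ω | ω ∩ F ∈ (openConn u t : Set (BondConfig (Fin n)))} →
      ∀ ω ∈ G, (ω ∈ openConn s t ↔ ω ∈ Bt ∪ (Z ∩ (Bt ∪ ((Xu ∩ Vt) ∪ (Xv ∩ Ut))))) := by
    rintro t ht Bt Vt Ut rfl rfl rfl ω hω
    rw [twoCut_conn_rootSide_iff hs (hGω ω hω) ht]
    simp only [Set.mem_union, Set.mem_inter_iff, Set.mem_setOf_eq, hZd, hXud, hXvd]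
    tauto
  have cB : ∀ ω ∈ G, (ω ∈ openConn s b ↔ ω ∈ Sb) := cfar hb Bb Vb Ub rfl rfl rfl
  have cC : ∀ ω ∈ G, (ω ∈ openConn s c ↔ ω ∈ Sc) := cfar hc Bc Vc Uc rfl rfl rfl
  rw [IncStar.sahiE3_congr_of_sure (hmeas G) hG1 cA cB cC, sahiE3_def]
  -- (2) locality
  have dF : ∀ p q : Fin n, DeterminedBy {ω : BondConfig (Fin n) | ω ∩ F ∈ (openConn p q : Set (BondConfig (Fin n)))} F :=
    fun p q => SahiRootSide.determinedBy_rootSide R p q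
  have dXu : DeterminedBy Xu F := dF s u
  have dXv : DeterminedBy Xv F := dF s v
  have dBb : DeterminedBy Bb F := dF s b
  have dBc : DeterminedBy Bc F := dF s c
  have dB1b : DeterminedBy B1b F :=
    (determinedBy_union_sdiff dBb (determinedBy_union_sdiff (dXu.inter (dF v b)) (dXv.inter (dF u b))).1).1
  have dB1c : DeterminedBy B1c F :=
    (determinedBy_union_sdiff dBc (determinedBy_union_sdiff (dXu.inter (dF v c)) (dXv.inter (dF u c))).1).1
  have sB : Bb ⊆ B1b := Set.subset_union_left
  have sC : Bc ⊆ B1c := Set.subset_union_left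
  -- (3) the seven moments
  have hBC : Sb ∩ Sc = (Bb ∩ Bc) ∪ (Z ∩ (B1b ∩ B1c)) := union_inter_union_eq Z sB sC
  have mb : (prodBernoulli w).real Sb = (1 - (prodBernoulli w).real Z) * (prodBernoulli w).real Bb
      + (prodBernoulli w).real Z * (prodBernoulli w).real B1b := real_twoLevel_eq w R u v sB dBb dB1b rfl
  have mc : (prodBernoulli w).real Sc = (1 - (prodBernoulli w).real Z) * (prodBernoulli w).real Bc
      + (prodBernoulli w).real Z * (prodBernoulli w).real B1c := real_twoLevel_eq w R u v sC dBc dB1c rfl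
  have mbc : (prodBernoulli w).real (Sb ∩ Sc) = (1 - (prodBernoulli w).real Z) * (prodBernoulli w).real (Bb ∩ Bc)
      + (prodBernoulli w).real Z * (prodBernoulli w).real (B1b ∩ B1c) := by
    rw [hBC]; exact real_twoLevel_eq w R u v (Set.inter_subset_inter sB sC) (dBb.inter dBc) (dB1b.inter dB1c) rfl
  have ma : (prodBernoulli w).real Sa = (prodBernoulli w).real (Au \ Av) * (prodBernoulli w).real Xu
      + (prodBernoulli w).real (Av \ Au) * (prodBernoulli w).real Xv
      + (prodBernoulli w).real (Au ∩ Av) * (prodBernoulli w).real (Xu ∪ Xv) := by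
    have h := real_nearTarget_inter_eq w R u v a (T₀ := Set.univ) (T₁ := Set.univ) subset_rfl dXu dXv
      (determinedBy_univ _) (determinedBy_univ _)
    simpa only [Set.inter_univ, Set.union_univ, Set.univ_union] using h
  have mab : (prodBernoulli w).real (Sa ∩ Sb) = (prodBernoulli w).real (Au \ Av) * (prodBernoulli w).real (Xu ∩ Bb)
      + (prodBernoulli w).real (Av \ Au) * (prodBernoulli w).real (Xv ∩ Bb)
      + (prodBernoulli w).real (Au ∩ Av) * (prodBernoulli w).real ((Xu ∪ Xv) ∩ B1b) :=
    real_nearTarget_inter_eq w R u v a sB dXu dXv dBb dB1b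
  have mac : (prodBernoulli w).real (Sa ∩ Sc) = (prodBernoulli w).real (Au \ Av) * (prodBernoulli w).real (Xu ∩ Bc)
      + (prodBernoulli w).real (Av \ Au) * (prodBernoulli w).real (Xv ∩ Bc)
      + (prodBernoulli w).real (Au ∩ Av) * (prodBernoulli w).real ((Xu ∪ Xv) ∩ B1c) :=
    real_nearTarget_inter_eq w R u v a sC dXu dXv dBc dB1c
  have mabc : (prodBernoulli w).real (Sa ∩ Sb ∩ Sc) = (prodBernoulli w).real (Au \ Av) * (prodBernoulli w).real (Xu ∩ (Bb ∩ Bc))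
      + (prodBernoulli w).real (Av \ Au) * (prodBernoulli w).real (Xv ∩ (Bb ∩ Bc))
      + (prodBernoulli w).real (Au ∩ Av) * (prodBernoulli w).real ((Xu ∪ Xv) ∩ (B1b ∩ B1c)) := by
    rw [Set.inter_assoc, hBC]
    exact real_nearTarget_inter_eq w R u v a (Set.inter_subset_inter sB sC) dXu dXv (dBb.inter dBc) (dB1b.inter dB1c)
  -- (4) assemble
  rw [mabc, mab, mac, mbc, ma, mb, mc]
  ring

/-! ### (M2): the star with all targets on the root side -/

set_option maxHeartbeats 400000 in
/-- **(M2) — the port star.**  For `u ∉ R` and `b, c ∈ R ∪ {u, v}`:  `E₃({s↔u},{s↔b},{s↔c}) = (1 − ζ) Φ_u + ζ Φ_Z` (notation of (M1));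
the outside of `R ∪ {u,v}` is felt only through `ζ = P(u ↔ v in Rᶜ)` (apply with `u, v` exchanged for the port `v`). [this work] -/
theorem oneTargetSide_sahiE3_port_eq (w : Sym2 (Fin n) → unitInterval) (R : Set (Fin n)) {s u v b c : Fin n}
    (hs : s ∈ R) (hu : u ∉ R) (hb : b ∈ R ∨ b = u ∨ b = v) (hc : c ∈ R ∨ c = u ∨ c = v)
    (hw : ∀ x ∈ R, ∀ z, z ∉ R → z ≠ u → z ≠ v → w s(x, z) = 0)
    {F : Set (Sym2 (Fin n))} (hF : F = {e : Sym2 (Fin n) | ∃ y ∈ R, y ∈ e})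
    {Xu Xv Bb Bc B1b B1c : Set (BondConfig (Fin n))}
    (hXu : Xu = {ω | ω ∩ F ∈ (openConn s u : Set (BondConfig (Fin n)))})
    (hXv : Xv = {ω | ω ∩ F ∈ (openConn s v : Set (BondConfig (Fin n)))})
    (hBb : Bb = {ω | ω ∩ F ∈ (openConn s b : Set (BondConfig (Fin n)))})
    (hBc : Bc = {ω | ω ∩ F ∈ (openConn s c : Set (BondConfig (Fin n)))})
    (hB1b : B1b = Bb ∪ ((Xu ∩ {ω | ω ∩ F ∈ (openConn v b : Set (BondConfig (Fin n)))})
      ∪ (Xv ∩ {ω | ω ∩ F ∈ (openConn u b : Set (BondConfig (Fin n)))})))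
    (hB1c : B1c = Bc ∪ ((Xu ∩ {ω | ω ∩ F ∈ (openConn v c : Set (BondConfig (Fin n)))})
      ∪ (Xv ∩ {ω | ω ∩ F ∈ (openConn u c : Set (BondConfig (Fin n)))})))
    {ζ xu ρ β γ m β₁ γ₁ m₁ pub puc pubc rb rc rbc : ℝ}
    (hζ : ζ = (prodBernoulli w).real (openConnIn Rᶜ u v))
    (hxu : xu = (prodBernoulli w).real Xu) (hρ : ρ = (prodBernoulli w).real (Xu ∪ Xv))
    (hβ : β = (prodBernoulli w).real Bb) (hγ : γ = (prodBernoulli w).real Bc) (hm : m = (prodBernoulli w).real (Bb ∩ Bc))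
    (hβ₁ : β₁ = (prodBernoulli w).real B1b) (hγ₁ : γ₁ = (prodBernoulli w).real B1c) (hm₁ : m₁ = (prodBernoulli w).real (B1b ∩ B1c))
    (hpub : pub = (prodBernoulli w).real (Xu ∩ Bb)) (hpuc : puc = (prodBernoulli w).real (Xu ∩ Bc))
    (hpubc : pubc = (prodBernoulli w).real (Xu ∩ (Bb ∩ Bc)))
    (hrb : rb = (prodBernoulli w).real ((Xu ∪ Xv) ∩ B1b)) (hrc : rc = (prodBernoulli w).real ((Xu ∪ Xv) ∩ B1c))
    (hrbc : rbc = (prodBernoulli w).real ((Xu ∪ Xv) ∩ (B1b ∩ B1c))) :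
    sahiE3 (prodBernoulli w) (openConn s u) (openConn s b) (openConn s c)
      = (1 - ζ) * (2 * pubc - pub * ((1 - ζ) * γ + ζ * γ₁) - puc * ((1 - ζ) * β + ζ * β₁) - ((1 - ζ) * m + ζ * m₁) * xu
              + xu * ((1 - ζ) * β + ζ * β₁) * ((1 - ζ) * γ + ζ * γ₁))
        + ζ * (2 * rbc - rb * ((1 - ζ) * γ + ζ * γ₁) - rc * ((1 - ζ) * β + ζ * β₁) - ((1 - ζ) * m + ζ * m₁) * ρ
              + ρ * ((1 - ζ) * β + ζ * β₁) * ((1 - ζ) * γ + ζ * γ₁)) := by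
  subst hζ hxu hρ hβ hγ hm hβ₁ hγ₁ hm₁ hpub hpuc hpubc hrb hrc hrbc
  subst hB1b hB1c
  subst hXu hXv hBb hBc
  subst hF
  have hmeas : ∀ X : Set (BondConfig (Fin n)), MeasurableSet X := fun _ => MeasurableSet.of_discrete
  set F : Set (Sym2 (Fin n)) := {e : Sym2 (Fin n) | ∃ y ∈ R, y ∈ e} with hFd
  set Xu : Set (BondConfig (Fin n)) := {ω | ω ∩ F ∈ (openConn s u : Set (BondConfig (Fin n)))} with hXud
  set Xv : Set (BondConfig (Fin n)) := {ω | ω ∩ F ∈ (openConn s v : Set (BondConfig (Fin n)))} with hXvd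
  set Bb : Set (BondConfig (Fin n)) := {ω | ω ∩ F ∈ (openConn s b : Set (BondConfig (Fin n)))} with hBbd
  set Bc : Set (BondConfig (Fin n)) := {ω | ω ∩ F ∈ (openConn s c : Set (BondConfig (Fin n)))} with hBcd
  set Vb : Set (BondConfig (Fin n)) := {ω | ω ∩ F ∈ (openConn v b : Set (BondConfig (Fin n)))} with hVbd
  set Ub : Set (BondConfig (Fin n)) := {ω | ω ∩ F ∈ (openConn u b : Set (BondConfig (Fin n)))} with hUbd
  set Vc : Set (BondConfig (Fin n)) := {ω | ω ∩ F ∈ (openConn v c : Set (BondConfig (Fin n)))} with hVcd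
  set Uc : Set (BondConfig (Fin n)) := {ω | ω ∩ F ∈ (openConn u c : Set (BondConfig (Fin n)))} with hUcd
  set B1b : Set (BondConfig (Fin n)) := Bb ∪ ((Xu ∩ Vb) ∪ (Xv ∩ Ub)) with hB1bd
  set B1c : Set (BondConfig (Fin n)) := Bc ∪ ((Xu ∩ Vc) ∪ (Xv ∩ Uc)) with hB1cd
  set Z : Set (BondConfig (Fin n)) := openConnIn Rᶜ u v with hZd
  set Su : Set (BondConfig (Fin n)) := Xu ∪ (Z ∩ (Xu ∪ Xv)) with hSu
  set Sb : Set (BondConfig (Fin n)) := Bb ∪ (Z ∩ B1b) with hSb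
  set Sc : Set (BondConfig (Fin n)) := Bc ∪ (Z ∩ B1c) with hSc
  -- (0) the sure set
  set G : Set (BondConfig (Fin n)) := {ω | ∀ e, w e = 0 → e ∉ ω}
  have hG1 : (prodBernoulli w).real G = 1 := IncStar.real_sureClosed w
  have hGω : ∀ ω ∈ G, ∀ x ∈ R, ∀ z, z ∉ R → z ≠ u → z ≠ v → s(x, z) ∉ ω :=
    fun ω hω x hx z hz hzu hzv => hω _ (hw x hx z hz hzu hzv)
  -- (1) the root events on the sure set
  have huc : u ∈ Rᶜ := hu
  have cU : ∀ ω ∈ G, (ω ∈ openConn s u ↔ ω ∈ Su) := by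
    intro ω hω
    rw [twoCut_conn_outside_iff hs (hGω ω hω) hu]
    simp only [hSu, Set.mem_union, Set.mem_inter_iff]
    constructor
    · rintro (⟨h₁, -⟩ | ⟨h₁, h₂⟩)
      · exact Or.inl h₁
      · refine Or.inr ⟨?_, Or.inr h₁⟩
        show ω ∈ openConnIn Rᶜ u v
        rw [openConnIn_comm]; exact h₂
    · rintro (h₁ | ⟨hZ, h₁ | h₁⟩)
      · exact Or.inl ⟨h₁, openConnIn_refl huc⟩
      · exact Or.inl ⟨h₁, openConnIn_refl huc⟩
      · refine Or.inr ⟨h₁, ?_⟩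
        show ω ∈ openConnIn Rᶜ v u
        rw [openConnIn_comm]; exact hZ
  have cfar : ∀ {t : Fin n} (ht : t ∈ R ∨ t = u ∨ t = v) (Bt Vt Ut : Set (BondConfig (Fin n))),
      Bt = {ω | ω ∩ F ∈ (openConn s t : Set (BondConfig (Fin n)))} →
      Vt = {ω | ω ∩ F ∈ (openConn v t : Set (BondConfig (Fin n)))} →
      Ut = {ω | ω ∩ F ∈ (openConn u t : Set (BondConfig (Fin n)))} →
      ∀ ω ∈ G, (ω ∈ openConn s t ↔ ω ∈ Bt ∪ (Z ∩ (Bt ∪ ((Xu ∩ Vt) ∪ (Xv ∩ Ut))))) := by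
    rintro t ht Bt Vt Ut rfl rfl rfl ω hω
    rw [twoCut_conn_rootSide_iff hs (hGω ω hω) ht]
    simp only [Set.mem_union, Set.mem_inter_iff, Set.mem_setOf_eq, hZd, hXud, hXvd]
    tauto
  have cB : ∀ ω ∈ G, (ω ∈ openConn s b ↔ ω ∈ Sb) := cfar hb Bb Vb Ub rfl rfl rfl
  have cC : ∀ ω ∈ G, (ω ∈ openConn s c ↔ ω ∈ Sc) := cfar hc Bc Vc Uc rfl rfl rfl
  rw [IncStar.sahiE3_congr_of_sure (hmeas G) hG1 cU cB cC, sahiE3_def]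
  -- (2) locality
  have dF : ∀ p q : Fin n, DeterminedBy {ω : BondConfig (Fin n) | ω ∩ F ∈ (openConn p q : Set (BondConfig (Fin n)))} F :=
    fun p q => SahiRootSide.determinedBy_rootSide R p q
  have dXu : DeterminedBy Xu F := dF s u
  have dXv : DeterminedBy Xv F := dF s v
  have dBb : DeterminedBy Bb F := dF s b
  have dBc : DeterminedBy Bc F := dF s c
  have dXuv : DeterminedBy (Xu ∪ Xv) F := (determinedBy_union_sdiff dXu dXv).1
  have dB1b : DeterminedBy B1b F :=
    (determinedBy_union_sdiff dBb (determinedBy_union_sdiff (dXu.inter (dF v b)) (dXv.inter (dF u b))).1).1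
  have dB1c : DeterminedBy B1c F :=
    (determinedBy_union_sdiff dBc (determinedBy_union_sdiff (dXu.inter (dF v c)) (dXv.inter (dF u c))).1).1
  have sU : Xu ⊆ Xu ∪ Xv := Set.subset_union_left
  have sB : Bb ⊆ B1b := Set.subset_union_left
  have sC : Bc ⊆ B1c := Set.subset_union_left
  -- (3) the seven moments
  have hBC : Sb ∩ Sc = (Bb ∩ Bc) ∪ (Z ∩ (B1b ∩ B1c)) := union_inter_union_eq Z sB sC
  have hUB : Su ∩ Sb = (Xu ∩ Bb) ∪ (Z ∩ ((Xu ∪ Xv) ∩ B1b)) := union_inter_union_eq Z sU sB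
  have hUC : Su ∩ Sc = (Xu ∩ Bc) ∪ (Z ∩ ((Xu ∪ Xv) ∩ B1c)) := union_inter_union_eq Z sU sC
  have hUBC : Su ∩ Sb ∩ Sc = (Xu ∩ (Bb ∩ Bc)) ∪ (Z ∩ ((Xu ∪ Xv) ∩ (B1b ∩ B1c))) := by
    rw [Set.inter_assoc, hBC]; exact union_inter_union_eq Z sU (Set.inter_subset_inter sB sC)
  have mU : (prodBernoulli w).real Su = (1 - (prodBernoulli w).real Z) * (prodBernoulli w).real Xu
      + (prodBernoulli w).real Z * (prodBernoulli w).real (Xu ∪ Xv) := real_twoLevel_eq w R u v sU dXu dXuv rfl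
  have mb : (prodBernoulli w).real Sb = (1 - (prodBernoulli w).real Z) * (prodBernoulli w).real Bb
      + (prodBernoulli w).real Z * (prodBernoulli w).real B1b := real_twoLevel_eq w R u v sB dBb dB1b rfl
  have mc : (prodBernoulli w).real Sc = (1 - (prodBernoulli w).real Z) * (prodBernoulli w).real Bc
      + (prodBernoulli w).real Z * (prodBernoulli w).real B1c := real_twoLevel_eq w R u v sC dBc dB1c rfl
  have mbc : (prodBernoulli w).real (Sb ∩ Sc) = (1 - (prodBernoulli w).real Z) * (prodBernoulli w).real (Bb ∩ Bc)
      + (prodBernoulli w).real Z * (prodBernoulli w).real (B1b ∩ B1c) := by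
    rw [hBC]; exact real_twoLevel_eq w R u v (Set.inter_subset_inter sB sC) (dBb.inter dBc) (dB1b.inter dB1c) rfl
  have mUb : (prodBernoulli w).real (Su ∩ Sb) = (1 - (prodBernoulli w).real Z) * (prodBernoulli w).real (Xu ∩ Bb)
      + (prodBernoulli w).real Z * (prodBernoulli w).real ((Xu ∪ Xv) ∩ B1b) := by
    rw [hUB]; exact real_twoLevel_eq w R u v (Set.inter_subset_inter sU sB) (dXu.inter dBb) (dXuv.inter dB1b) rfl
  have mUc : (prodBernoulli w).real (Su ∩ Sc) = (1 - (prodBernoulli w).real Z) * (prodBernoulli w).real (Xu ∩ Bc)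
      + (prodBernoulli w).real Z * (prodBernoulli w).real ((Xu ∪ Xv) ∩ B1c) := by
    rw [hUC]; exact real_twoLevel_eq w R u v (Set.inter_subset_inter sU sC) (dXu.inter dBc) (dXuv.inter dB1c) rfl
  have mUbc : (prodBernoulli w).real (Su ∩ Sb ∩ Sc) = (1 - (prodBernoulli w).real Z) * (prodBernoulli w).real (Xu ∩ (Bb ∩ Bc))
      + (prodBernoulli w).real Z * (prodBernoulli w).real ((Xu ∪ Xv) ∩ (B1b ∩ B1c)) := by
    rw [hUBC]
    exact real_twoLevel_eq w R u v (Set.inter_subset_inter sU (Set.inter_subset_inter sB sC)) (dXu.inter (dBb.inter dBc))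
      (dXuv.inter (dB1b.inter dB1c)) rfl
  -- (4) assemble
  rw [mUbc, mUb, mUc, mbc, mU, mb, mc]
  ring

end IncStarOneTargetSide

end Summit.CriticalPhenomena.PercolationContinuityZ3.Theorems
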